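import Mathlib
import Summits.Ventures.PercRepro2.HCov
import Summits.Ventures.PercRepro2.EdgeCubic
import Summits.Ventures.PercRepro2.KPrimePendantLemmas

/-!
# The closed pin of a pendant root edge: the root is isolated (blind cell PercRepro2, p5 g21;
`proofs/P5-OEDGE.md` §27; the dictionary `B1 = 2·Φ` is in `FirstOrderPendant.lean`)

Let the root `a₂` be a LEAF: its only edge is `e = {a₂, z}`.  At the closed pin `p[e↦0]` the root is
isolated, so every `C₂`-mass vanishes, `P(Q) = 1`, `T = ∅`, `PD = {a₃ ∉ C₁}`, `T′ = {a₃ ∈ C₁}`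
(`closed_*`), and `Gc₀ = 0`.  The one-copy Bernstein coefficient `EdgeLine.B1` of the root edge is then
exactly twice the first-order functional `Φ` of `FirstOrderTerms.lean`, evaluated at the open pin with
`z := a₂` (**`B1_eq_two_Phi`**: the three closed-pin scalars `β, D₀, D_o⁰` of `Φ` are flip-invariant
(`KPrime.flipInvAt_*`), the open-pin events of `Φ` are the world masses `T′ ∩ oH ∩ bH`, `(PD ⊔ T′) ∩ oH`,
`(PD ⊔ T) ∩ bH`, `T ∩ …`; then `ring`).  With `Phi_nonneg`:

**`B1_nonneg_pendant_root`**: `0 ≤ B1` at every pendant root edge — the first-order (HCOV) in the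
tree's Bernstein vocabulary (row 2′CPOLAR's one-copy coefficient at the pendant root edges is a
THEOREM).
-/

namespace Summit.Ventures.PercRepro2

open UnionCluster

namespace CovForm

namespace FirstOrder

section ClosedPin

variable {V : Type*} {E : Type*} [Fintype E] [DecidableEq E] [Fintype V] [DecidableEq V]
  {R : Type*} [Field R] [LinearOrder R] [IsStrictOrderedRing R]
variable {ends : E → Sym2 V} {p : E → R} {e : E} {a₂ : V}

omit [Fintype E] [Fintype V] [DecidableEq V] [LinearOrder R] [IsStrictOrderedRing R] in
/-- On the sure set of the closed pin the leaf `a₂` is isolated. -/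
lemma not_conn_leaf_of_mem_sureSet (hleaf : ∀ f, a₂ ∈ ends f → f = e) {ω : Config E}
    (hω : ω ∈ KPrime.sureSet (Function.update p e 0)) {y : V} (hy : y ≠ a₂) :
    ¬ Conn ends ω a₂ y := fun h =>
  hy (KPrime.conn_eq_of_isolated hleaf (hω.2 e (by simp)) h)

omit [Fintype V] [DecidableEq V] [LinearOrder R] [IsStrictOrderedRing R] in
/-- With the pendant edge pinned closed, an event inside `{a₂ ↔ y}` (`y ≠ a₂`) is null. -/
lemma prob_closed_eq_zero_of_subset (hleaf : ∀ f, a₂ ∈ ends f → f = e) {y : V} (hy : y ≠ a₂)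
    {A : Set (Config E)} (hA : A ⊆ connEvent ends a₂ y) : prob (Function.update p e 0) A = 0 := by
  apply KPrime.prob_eq_zero_of_inter_sureSet_eq_empty
  ext ω
  simp only [Set.mem_inter_iff, Set.mem_empty_iff_false, iff_false, not_and]
  intro hωA hω
  exact not_conn_leaf_of_mem_sureSet hleaf hω hy (hA hωA)

omit [Fintype V] [DecidableEq V] [LinearOrder R] [IsStrictOrderedRing R] in
/-- Events agreeing on the sure set of the closed pin have the same mass. -/
lemma prob_closed_congr {A B : Set (Config E)}
    (h : ∀ ω ∈ KPrime.sureSet (Function.update p e 0), (ω ∈ A ↔ ω ∈ B)) :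
    prob (Function.update p e 0) A = prob (Function.update p e 0) B := by
  apply KPrime.prob_congr_sure
  ext ω
  simp only [Set.mem_inter_iff]
  constructor
  · rintro ⟨hA, hω⟩; exact ⟨(h ω hω).1 hA, hω⟩
  · rintro ⟨hB, hω⟩; exact ⟨(h ω hω).2 hB, hω⟩

omit [Fintype V] [DecidableEq V] [LinearOrder R] [IsStrictOrderedRing R] in
/-- `Q ∩ Y = Y` at the closed pin. -/
lemma closed_Q_inter (hleaf : ∀ f, a₂ ∈ ends f → f = e) {a₁ : V} (h1 : a₁ ≠ a₂) (Y : Set (Config E)) :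
    prob (Function.update p e 0) (avoidAll ends a₂ {a₁} ∩ Y) = prob (Function.update p e 0) Y := by
  apply prob_closed_congr
  intro ω hω
  simp only [Set.mem_inter_iff, mem_avoidAll, Finset.mem_singleton, forall_eq]
  exact ⟨fun h => h.2, fun h => ⟨not_conn_leaf_of_mem_sureSet hleaf hω h1, h⟩⟩

omit [Fintype V] [DecidableEq V] [LinearOrder R] [IsStrictOrderedRing R] in
/-- `PD ∩ Y = {a₃ ∉ C₁} ∩ Y` at the closed pin. -/
lemma closed_PD_inter (hleaf : ∀ f, a₂ ∈ ends f → f = e) {a₁ a₃ : V} (h1 : a₁ ≠ a₂) (h3 : a₃ ≠ a₂) (Y : Set (Config E)) :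
    prob (Function.update p e 0) (PDEvent ends a₁ a₂ a₃ ∩ Y) =
      prob (Function.update p e 0) (avoidAll ends a₁ {a₃} ∩ Y) := by
  apply prob_closed_congr
  intro ω hω
  have h21 := not_conn_leaf_of_mem_sureSet hleaf hω h1
  have h23 := not_conn_leaf_of_mem_sureSet hleaf hω h3
  have h12 : ¬ Conn ends ω a₁ a₂ := fun h => h21 (conn_symm h)
  have h32 : ¬ Conn ends ω a₃ a₂ := fun h => h23 (conn_symm h)
  have h13 : Conn ends ω a₃ a₁ ↔ Conn ends ω a₁ a₃ := ⟨conn_symm, conn_symm⟩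
  simp only [Set.mem_inter_iff, PDEvent, Dtilde, inU, Set.mem_compl_iff, Set.mem_union,
    mem_connEvent, mem_avoidAll, Finset.mem_singleton, forall_eq, not_or]
  tauto

omit [Fintype V] [DecidableEq V] [LinearOrder R] [IsStrictOrderedRing R] in
/-- `T′ ∩ Y = {a₃ ∈ C₁} ∩ Y` at the closed pin. -/
lemma closed_Tp_inter (hleaf : ∀ f, a₂ ∈ ends f → f = e) {a₁ a₃ : V} (h1 : a₁ ≠ a₂) (Y : Set (Config E)) :
    prob (Function.update p e 0) (TEvent ends a₂ a₁ a₃ ∩ Y) =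
      prob (Function.update p e 0) (connEvent ends a₁ a₃ ∩ Y) := by
  apply prob_closed_congr
  intro ω hω
  have h21 := not_conn_leaf_of_mem_sureSet hleaf hω h1
  have h12 : ¬ Conn ends ω a₁ a₂ := fun h => h21 (conn_symm h)
  simp only [Set.mem_inter_iff, TEvent, Set.mem_compl_iff, mem_connEvent]
  tauto

omit [Fintype V] [DecidableEq V] [LinearOrder R] [IsStrictOrderedRing R] in
/-- `T ∩ Y` is null at the closed pin. -/
lemma closed_T_inter (hleaf : ∀ f, a₂ ∈ ends f → f = e) {a₁ a₃ : V} (h3 : a₃ ≠ a₂) (Y : Set (Config E)) :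
    prob (Function.update p e 0) (TEvent ends a₁ a₂ a₃ ∩ Y) = 0 :=
  prob_closed_eq_zero_of_subset (p := p) hleaf h3 (A := TEvent ends a₁ a₂ a₃ ∩ Y) fun _ h => h.1.2

omit [Fintype V] [DecidableEq V] [LinearOrder R] [IsStrictOrderedRing R] in
/-- `P(Q) = 1` at the closed pin. -/
lemma closed_Q (hleaf : ∀ f, a₂ ∈ ends f → f = e) {a₁ : V} (h1 : a₁ ≠ a₂) :
    prob (Function.update p e 0) (avoidAll ends a₂ {a₁}) = 1 := by
  have := closed_Q_inter (p := p) hleaf h1 (Set.univ : Set (Config E))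
  rwa [Set.inter_univ, prob_univ] at this

omit [Fintype V] [DecidableEq V] [LinearOrder R] [IsStrictOrderedRing R] in
/-- `P(PD) = P(a₃ ∉ C₁)` at the closed pin. -/
lemma closed_PD (hleaf : ∀ f, a₂ ∈ ends f → f = e) {a₁ a₃ : V} (h1 : a₁ ≠ a₂) (h3 : a₃ ≠ a₂) :
    prob (Function.update p e 0) (PDEvent ends a₁ a₂ a₃) =
      prob (Function.update p e 0) (avoidAll ends a₁ {a₃}) := by
  have := closed_PD_inter (p := p) hleaf h1 h3 (Set.univ : Set (Config E))
  rwa [Set.inter_univ, Set.inter_univ] at this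

omit [Fintype V] [DecidableEq V] [LinearOrder R] [IsStrictOrderedRing R] in
/-- `D_o = P(a₃ ∉ C₁, o ∈ C₁)` at the closed pin. -/
lemma closed_Do (hleaf : ∀ f, a₂ ∈ ends f → f = e) {o a₁ a₃ : V} (ho : o ≠ a₂) (h1 : a₁ ≠ a₂) (h3 : a₃ ≠ a₂) :
    Do (Function.update p e 0) ends o a₁ a₂ a₃ =
      prob (Function.update p e 0) (avoidAll ends a₁ {a₃} ∩ connEvent ends a₁ o) := by
  unfold Do
  rw [closed_PD_inter hleaf h1 h3 (connEvent ends a₁ o),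
    prob_closed_eq_zero_of_subset hleaf ho (A := PDEvent ends a₁ a₂ a₃ ∩ connEvent ends a₂ o) (fun _ h => h.2),
    add_zero]

omit [Fintype E] [DecidableEq E] [Fintype V] [DecidableEq V] [LinearOrder R] [IsStrictOrderedRing R] in
/-- `avoidAll a₁ {a₃} = {a₁ ↔ a₃}ᶜ`. -/
lemma avoidAll_singleton_eq_compl (ends : E → Sym2 V) (a₁ a₃ : V) :
    avoidAll ends a₁ {a₃} = (connEvent ends a₁ a₃)ᶜ := by
  ext ω
  simp [avoidAll]

omit [Fintype V] [DecidableEq V] [LinearOrder R] [IsStrictOrderedRing R] in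
/-- The split of an event by `{a₃ ∈ C₁}`. -/
lemma split_a₃ (q : E → R) (a₁ a₃ : V) (X : Set (Config E)) :
    prob q X = prob q (avoidAll ends a₁ {a₃} ∩ X) + prob q (connEvent ends a₁ a₃ ∩ X) := by
  have h := prob_inter_add_prob_inter_compl q X (connEvent ends a₁ a₃)
  rw [Set.inter_comm X, Set.inter_comm X] at h
  rw [avoidAll_singleton_eq_compl]
  linear_combination -h

omit [Fintype V] [DecidableEq V] [LinearOrder R] [IsStrictOrderedRing R] in
/-- `E_Q[σ_b σ_o] = P(o, b ∈ C₁)` at the closed pin, split by `{a₃ ∈ C₁}`. -/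
lemma closed_EQbo (hleaf : ∀ f, a₂ ∈ ends f → f = e) {o a₁ b : V} (ho : o ≠ a₂) (h1 : a₁ ≠ a₂) (hb : b ≠ a₂) (a₃ : V) :
    EQbo (Function.update p e 0) ends o a₁ a₂ b =
      prob (Function.update p e 0) (avoidAll ends a₁ {a₃} ∩ (connEvent ends a₁ o ∩ connEvent ends a₁ b)) +
        prob (Function.update p e 0) (connEvent ends a₁ a₃ ∩ (connEvent ends a₁ o ∩ connEvent ends a₁ b)) := by
  unfold EQbo
  rw [closed_Q_inter hleaf h1 (connEvent ends a₁ o ∩ connEvent ends a₁ b),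
    prob_closed_eq_zero_of_subset hleaf ho
      (A := avoidAll ends a₂ {a₁} ∩ (connEvent ends a₂ o ∩ connEvent ends a₂ b)) (fun _ h => h.2.1),
    prob_closed_eq_zero_of_subset hleaf ho
      (A := avoidAll ends a₂ {a₁} ∩ (connEvent ends a₂ o ∩ connEvent ends a₁ b)) (fun _ h => h.2.1),
    prob_closed_eq_zero_of_subset hleaf hb
      (A := avoidAll ends a₂ {a₁} ∩ (connEvent ends a₁ o ∩ connEvent ends a₂ b)) (fun _ h => h.2.2),
    ← split_a₃]
  ring

omit [Fintype V] [DecidableEq V] [LinearOrder R] [IsStrictOrderedRing R] in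
/-- `E_Q[σ_b σ₃] = P(a₃ ∈ C₁, b ∈ C₁)` at the closed pin. -/
lemma closed_EQb3 (hleaf : ∀ f, a₂ ∈ ends f → f = e) {a₁ a₃ b : V} (h1 : a₁ ≠ a₂) (h3 : a₃ ≠ a₂) (hb : b ≠ a₂) :
    EQb3 (Function.update p e 0) ends a₁ a₂ a₃ b =
      prob (Function.update p e 0) (connEvent ends a₁ a₃ ∩ connEvent ends a₁ b) := by
  unfold EQb3
  rw [closed_Tp_inter hleaf h1 (connEvent ends a₁ b), closed_T_inter hleaf h3 (connEvent ends a₂ b),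
    closed_T_inter hleaf h3 (connEvent ends a₁ b),
    prob_closed_eq_zero_of_subset hleaf hb (A := TEvent ends a₂ a₁ a₃ ∩ connEvent ends a₂ b)
      (fun _ h => h.2)]
  ring

omit [Fintype V] [DecidableEq V] [LinearOrder R] [IsStrictOrderedRing R] in
/-- `E_Q[σ_b σ₃ 1_{o∈U}] = P(a₃, o, b ∈ C₁)` at the closed pin. -/
lemma closed_EQb3o (hleaf : ∀ f, a₂ ∈ ends f → f = e) {o a₁ a₃ b : V} (ho : o ≠ a₂) (h1 : a₁ ≠ a₂) (h3 : a₃ ≠ a₂) (hb : b ≠ a₂) :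
    EQb3o (Function.update p e 0) ends o a₁ a₂ a₃ b =
      prob (Function.update p e 0) (connEvent ends a₁ a₃ ∩ (connEvent ends a₁ o ∩ connEvent ends a₁ b)) := by
  unfold EQb3o
  rw [closed_Tp_inter hleaf h1 (connEvent ends a₁ o ∩ connEvent ends a₁ b),
    prob_closed_eq_zero_of_subset hleaf ho
      (A := TEvent ends a₂ a₁ a₃ ∩ (connEvent ends a₂ o ∩ connEvent ends a₁ b)) (fun _ h => h.2.1),
    closed_T_inter hleaf h3 (connEvent ends a₁ o ∩ connEvent ends a₂ b),
    closed_T_inter hleaf h3 (connEvent ends a₂ o ∩ connEvent ends a₂ b),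
    closed_T_inter hleaf h3 (connEvent ends a₁ o ∩ connEvent ends a₁ b),
    closed_T_inter hleaf h3 (connEvent ends a₂ o ∩ connEvent ends a₁ b),
    prob_closed_eq_zero_of_subset hleaf hb
      (A := TEvent ends a₂ a₁ a₃ ∩ (connEvent ends a₁ o ∩ connEvent ends a₂ b)) (fun _ h => h.2.2),
    prob_closed_eq_zero_of_subset hleaf ho
      (A := TEvent ends a₂ a₁ a₃ ∩ (connEvent ends a₂ o ∩ connEvent ends a₂ b)) (fun _ h => h.2.1)]
  ring

omit [Fintype V] [DecidableEq V] [LinearOrder R] [IsStrictOrderedRing R] in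
/-- `E_Q[σ_o] = P(o ∈ C₁)` at the closed pin, split by `{a₃ ∈ C₁}`. -/
lemma closed_EQo (hleaf : ∀ f, a₂ ∈ ends f → f = e) {o a₁ : V} (ho : o ≠ a₂) (h1 : a₁ ≠ a₂) (a₃ : V) :
    EQo (Function.update p e 0) ends o a₁ a₂ =
      prob (Function.update p e 0) (avoidAll ends a₁ {a₃} ∩ connEvent ends a₁ o) +
        prob (Function.update p e 0) (connEvent ends a₁ a₃ ∩ connEvent ends a₁ o) := by
  unfold EQo
  rw [closed_Q_inter hleaf h1 (connEvent ends a₁ o),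
    prob_closed_eq_zero_of_subset hleaf ho (A := avoidAll ends a₂ {a₁} ∩ connEvent ends a₂ o)
      (fun _ h => h.2), ← split_a₃]
  ring

omit [Fintype V] [DecidableEq V] [LinearOrder R] [IsStrictOrderedRing R] in
/-- `E_Q[σ₃] = P(a₃ ∈ C₁) = 1 − P(a₃ ∉ C₁)` at the closed pin. -/
lemma closed_EQ3 (hleaf : ∀ f, a₂ ∈ ends f → f = e) {a₁ a₃ : V} (h1 : a₁ ≠ a₂) (h3 : a₃ ≠ a₂) :
    EQ3 (Function.update p e 0) ends a₁ a₂ a₃ =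
      1 - prob (Function.update p e 0) (avoidAll ends a₁ {a₃}) := by
  unfold EQ3
  have hTp := closed_Tp_inter (p := p) hleaf h1 (a₃ := a₃) (Set.univ : Set (Config E))
  rw [Set.inter_univ, Set.inter_univ] at hTp
  have hT := closed_T_inter (p := p) hleaf h3 (a₁ := a₁) (Set.univ : Set (Config E))
  rw [Set.inter_univ] at hT
  rw [hTp, hT, avoidAll_singleton_eq_compl, prob_compl]
  ring

omit [Fintype V] [DecidableEq V] [LinearOrder R] [IsStrictOrderedRing R] in
/-- `E_Q[σ₃ 1_{o∈U}] = P(a₃ ∈ C₁, o ∈ C₁)` at the closed pin. -/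
lemma closed_EQ3o (hleaf : ∀ f, a₂ ∈ ends f → f = e) {o a₁ a₃ : V} (ho : o ≠ a₂) (h1 : a₁ ≠ a₂) (h3 : a₃ ≠ a₂) :
    EQ3o (Function.update p e 0) ends o a₁ a₂ a₃ =
      prob (Function.update p e 0) (connEvent ends a₁ a₃ ∩ connEvent ends a₁ o) := by
  unfold EQ3o
  rw [closed_Tp_inter hleaf h1 (connEvent ends a₁ o),
    prob_closed_eq_zero_of_subset hleaf ho (A := TEvent ends a₂ a₁ a₃ ∩ connEvent ends a₂ o)
      (fun _ h => h.2),
    closed_T_inter hleaf h3 (connEvent ends a₁ o), closed_T_inter hleaf h3 (connEvent ends a₂ o)]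
  ring

omit [Fintype V] [DecidableEq V] [LinearOrder R] [IsStrictOrderedRing R] in
/-- `P(PD, b ∈ U) = P(a₃ ∉ C₁, b ∈ C₁)` at the closed pin. -/
lemma closed_PDb (hleaf : ∀ f, a₂ ∈ ends f → f = e) {a₁ a₃ b : V} (h1 : a₁ ≠ a₂) (h3 : a₃ ≠ a₂) (hb : b ≠ a₂) :
    PDb (Function.update p e 0) ends a₁ a₂ a₃ b =
      prob (Function.update p e 0) (avoidAll ends a₁ {a₃} ∩ connEvent ends a₁ b) := by
  unfold PDb
  rw [closed_PD_inter hleaf h1 h3 (connEvent ends a₁ b),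
    prob_closed_eq_zero_of_subset hleaf hb (A := PDEvent ends a₁ a₂ a₃ ∩ connEvent ends a₂ b)
      (fun _ h => h.2), add_zero]

omit [Fintype V] [DecidableEq V] [LinearOrder R] [IsStrictOrderedRing R] in
/-- `P(PD, b ∈ U, o ∈ U) = P(a₃ ∉ C₁, o, b ∈ C₁)` at the closed pin. -/
lemma closed_PDbo (hleaf : ∀ f, a₂ ∈ ends f → f = e) {o a₁ a₃ b : V} (ho : o ≠ a₂) (h1 : a₁ ≠ a₂) (h3 : a₃ ≠ a₂) (hb : b ≠ a₂) :
    PDbo (Function.update p e 0) ends o a₁ a₂ a₃ b =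
      prob (Function.update p e 0) (avoidAll ends a₁ {a₃} ∩ (connEvent ends a₁ o ∩ connEvent ends a₁ b)) := by
  unfold PDbo
  rw [closed_PD_inter hleaf h1 h3 (connEvent ends a₁ o ∩ connEvent ends a₁ b),
    prob_closed_eq_zero_of_subset hleaf ho
      (A := PDEvent ends a₁ a₂ a₃ ∩ (connEvent ends a₂ o ∩ connEvent ends a₁ b)) (fun _ h => h.2.1),
    prob_closed_eq_zero_of_subset hleaf hb
      (A := PDEvent ends a₁ a₂ a₃ ∩ (connEvent ends a₁ o ∩ connEvent ends a₂ b)) (fun _ h => h.2.2),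
    prob_closed_eq_zero_of_subset hleaf ho
      (A := PDEvent ends a₁ a₂ a₃ ∩ (connEvent ends a₂ o ∩ connEvent ends a₂ b)) (fun _ h => h.2.1)]
  ring

omit [Fintype V] [DecidableEq V] in
/-- `gap = −P(b ∈ C₁)` at the closed pin, split by `{a₃ ∈ C₁}`. -/
lemma closed_gap (hleaf : ∀ f, a₂ ∈ ends f → f = e) {a₁ b : V} (h1 : a₁ ≠ a₂) (hb : b ≠ a₂) (a₃ : V) :
    gap (Function.update p e 0) ends a₁ a₂ b =
      -(prob (Function.update p e 0) (avoidAll ends a₁ {a₃} ∩ connEvent ends a₁ b) +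
        prob (Function.update p e 0) (connEvent ends a₁ a₃ ∩ connEvent ends a₁ b)) := by
  rw [gap_eq_Q, closed_Q_inter hleaf h1 (connEvent ends a₁ b),
    prob_closed_eq_zero_of_subset hleaf hb (A := avoidAll ends a₂ {a₁} ∩ connEvent ends a₂ b)
      (fun _ h => h.2), ← split_a₃]
  ring

end ClosedPin

end FirstOrder

end CovForm

end Summit.Ventures.PercRepro2
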